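import Summits.QuantumFields.YangMills.Theorems.WeakCouplingRatesCalibrationRP
import Summits.Ventures.YMGap.RobustBall.TransferGap
import HarnessLib

/-!
# Weak-coupling rates, calibration part 2/3: transfer gap (bond reflection, OS reconstruction) ⇒ RP-spectral gap (site reflection)

NOT THE CLAY GAP.  Cell `ym-beyond`, seat P3 (rung R2ξ, caption «not the Clay direction; constraint on R2c schemes»).  Main theorem (`d = 4`,
compact second-countable `G`, `β ≥ 0`):
`hasRPTimeGap_of_hasInfiniteVolumeGap : HasInfiniteVolumeGap r β m → μ ∈ oddTorusLimitPoints r β → HasRPTimeGap μ m` —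
if every odd-torus limit state is OS-reconstructible for the bond reflection with transfer data of mass gap `≥ m` (the ladder's currency,
`TransferData.HasMassGap`: `‖T|_{Ω^⊥}‖ ≤ e^{-m}`), then for every bounded continuous positive-time cylinder observable `F` and every `t`,
`rpCorr μ F t ≤ e^{-m t} · rpCorr μ F 0` (P3's currency).  Proof: for `t ≥ 1` the site-reflection correlator `rpCorr μ F t` is the bond matrix
element `⟪w, T^{t-1} w⟫`, `w` = the component of `ι F` orthogonal to the vacuum (translation invariance of torus-limit states, B-TI), so
`rpCorr μ F (k+1) ≤ e^{-m k} rpCorr μ F 1`; the one non-formal step `rpCorr μ F 1 ≤ e^{-m} rpCorr μ F 0` is log-convexity between the SITE-RP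
Gram value `rpCorr μ F 0 ≥ 0` (part 1, §B) and the bond values at `t = 1, 2` (discriminant of `l ↦ rpCorr μ (F + l·F∘α₁) 0 ≥ 0`).
References: K. Osterwalder, E. Seiler, Ann. Phys. 110 (1978) §2; J. Glimm, A. Jaffe, Quantum Physics (1987) Thm. 6.1.3; E. Seiler, LNP 159 Ch. 2.
-/

set_option autoImplicit false

noncomputable section

open scoped BigOperators Topology ComplexConjugate ComplexOrder InnerProductSpace
open MeasureTheory Filter
open Literature.MathematicalPhysics Literature.MathematicalPhysics.QuantumFieldTheory
  Literature.MathematicalPhysics.QuantumLattice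
open Literature.Probability.LatticeModels (IsOSReconstructible IsBoundedMeasurable positiveEvents osForm
  TransferData)
open Summit.QuantumFields.YangMills.Theorems.ClusteringToYangMills.Reconstructible
open Summit.QuantumFields.YangMills.Theorems.CriticalContinuumLimit
open Summit.QuantumFields.YangMills.Theorems.CriticalContinuumLimit.AdmissibleGap
open Summit.Ventures.YMGap.RobustBall.TransferGap (iterate_gaugeTimeShift_eq
  oddTorusLimitPoints_subset_infiniteVolumeLimitPoints)

namespace Summit.QuantumFields.YangMills.Theorems.WeakCouplingRates

/-! ### §C. Transfer gap (bond reflection, OS reconstruction) ⇒ RP-spectral gap (site reflection, P3's currency) -/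

section TransferToRP

variable {G : Type} [Group G] [TopologicalSpace G] [IsTopologicalGroup G] [CompactSpace G]
  [MeasurableSpace G] [BorelSpace G]

omit [TopologicalSpace G] [IsTopologicalGroup G] [CompactSpace G] [BorelSpace G] in
/-- `α_1 ∘ θ = Θ` (P3's unit time shift of the site-reflected field is the bond-reflected field). [folklore] -/
@[simp] theorem timeShiftLG_one_timeReflectLG (U : LGConfig 4 G) :
    timeShiftLG (G := G) 1 (timeReflectLG U) = gaugeTimeReflect U := by
  rw [timeShiftLG_one_apply, gaugeTimeShift_timeReflectLG]

omit [Group G] [TopologicalSpace G] [IsTopologicalGroup G] [CompactSpace G] [BorelSpace G] in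
/-- `α_k ∘ τ = α_{k+1}`. [folklore] -/
theorem timeShiftLG_gaugeTimeShift (k : ℕ) (U : LGConfig 4 G) :
    timeShiftLG (G := G) k (gaugeTimeShift U) = timeShiftLG (G := G) (k + 1) U := by
  rw [← timeShiftLG_one_apply, timeShiftLG_timeShiftLG, Nat.add_comm]

omit [Group G] [TopologicalSpace G] [IsTopologicalGroup G] [CompactSpace G] [BorelSpace G] in
/-- Iterates of `τ` are P3's `timeShiftLG` (the RobustBall lemma `iterate_gaugeTimeShift_eq`, read through the abbreviation). [folklore] -/
private theorem gaugeTimeShift_iterate (k : ℕ) (U : LGConfig 4 G) :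
    gaugeTimeShift^[k] U = timeShiftLG (G := G) k U :=
  iterate_gaugeTimeShift_eq k U

variable {μ : Measure (LGConfig 4 G)}

omit [Group G] [IsTopologicalGroup G] [CompactSpace G] in
/-- Bounded continuous real observables are integrable for a finite measure. [folklore] -/
private theorem integrable_of_continuous_bdd [SecondCountableTopology G] [IsFiniteMeasure μ]
    {g : LGConfig 4 G → ℝ} (hc : Continuous g) (hb : ∃ C : ℝ, ∀ U, |g U| ≤ C) : Integrable g μ := by
  obtain ⟨C, hC⟩ := hb
  exact Integrable.of_bound hc.measurable.aestronglyMeasurable C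
    (ae_of_all _ fun U => by simpa [Real.norm_eq_abs] using hC U)

omit [Group G] [TopologicalSpace G] [IsTopologicalGroup G] [CompactSpace G] [MeasurableSpace G]
  [BorelSpace G] in
/-- Products of bounded functions are bounded. [folklore] -/
private theorem bdd_mul {g₁ g₂ : LGConfig 4 G → ℝ} (h₁ : ∃ C : ℝ, ∀ U, |g₁ U| ≤ C) (h₂ : ∃ C : ℝ, ∀ U, |g₂ U| ≤ C) :
    ∃ C : ℝ, ∀ U, |g₁ U * g₂ U| ≤ C := by
  obtain ⟨C₁, hC₁⟩ := h₁
  obtain ⟨C₂, hC₂⟩ := h₂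
  exact ⟨C₁ * C₂, fun U => by
    rw [abs_mul]
    exact mul_le_mul (hC₁ _) (hC₂ _) (abs_nonneg _) ((abs_nonneg (g₁ U)).trans (hC₁ U))⟩

omit [Group G] [IsTopologicalGroup G] [CompactSpace G] in
/-- Bilinear expansion of `∫ (a + l b)(c + l d)` for bounded continuous real observables. [folklore] -/
private theorem integral_add_mul_add [SecondCountableTopology G] [IsFiniteMeasure μ]
    {a b c d : LGConfig 4 G → ℝ} (ha : Continuous a) (ha' : ∃ C : ℝ, ∀ U, |a U| ≤ C)
    (hb : Continuous b) (hb' : ∃ C : ℝ, ∀ U, |b U| ≤ C) (hc : Continuous c) (hc' : ∃ C : ℝ, ∀ U, |c U| ≤ C)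
    (hd : Continuous d) (hd' : ∃ C : ℝ, ∀ U, |d U| ≤ C) (l : ℝ) :
    ∫ U, (a U + l * b U) * (c U + l * d U) ∂μ =
      (∫ U, a U * c U ∂μ) + l * (∫ U, a U * d U ∂μ) + l * (∫ U, b U * c U ∂μ)
        + l * l * (∫ U, b U * d U ∂μ) := by
  have iac : Integrable (fun U => a U * c U) μ := integrable_of_continuous_bdd (ha.mul hc) (bdd_mul ha' hc')
  have iad : Integrable (fun U => a U * d U) μ := integrable_of_continuous_bdd (ha.mul hd) (bdd_mul ha' hd')
  have ibc : Integrable (fun U => b U * c U) μ := integrable_of_continuous_bdd (hb.mul hc) (bdd_mul hb' hc')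
  have ibd : Integrable (fun U => b U * d U) μ := integrable_of_continuous_bdd (hb.mul hd) (bdd_mul hb' hd')
  have h1 : (fun U => (a U + l * b U) * (c U + l * d U)) =
      fun U => a U * c U + l * (a U * d U) + l * (b U * c U) + l * l * (b U * d U) := by
    funext U; ring
  rw [h1, integral_add, integral_add, integral_add, integral_const_mul, integral_const_mul,
    integral_const_mul]
  · exact iac
  · exact iad.const_mul l
  · exact iac.add (iad.const_mul l)
  · exact ibc.const_mul l
  · exact (iac.add (iad.const_mul l)).add (ibc.const_mul l)
  · exact ibd.const_mul (l * l)

variable [SecondCountableTopology G] (r : LatticeRep G) {β : ℝ}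

omit [SecondCountableTopology G] in
/-- Translation invariance of odd-torus limit states under the unit time shift `τ`, on bounded continuous cylinder observables
(tree B-TI `integral_comp_configShift_of_mem_limitPoints`). [folklore] -/
theorem integral_comp_gaugeTimeShift (hμ : μ ∈ oddTorusLimitPoints r β) {g : LGConfig 4 G → ℝ}
    {Λ : Finset (QuantumLattice.ZdEdge 4)} (hg : IsCylinder g Λ) (hgc : Continuous g)
    (hgb : ∃ C : ℝ, ∀ U, |g U| ≤ C) :
    ∫ U, g (gaugeTimeShift U) ∂μ = ∫ U, g U ∂μ :=
  integral_comp_configShift_of_mem_limitPoints r.ρ (oddTorusLimitPoints_subset_infiniteVolumeLimitPoints r β hμ) _ hg hgc hgb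

omit [SecondCountableTopology G] in
/-- Translation invariance under `α_k`. [folklore] -/
theorem integral_comp_timeShiftLG (hμ : μ ∈ oddTorusLimitPoints r β) {g : LGConfig 4 G → ℝ}
    {Λ : Finset (QuantumLattice.ZdEdge 4)} (hg : IsCylinder g Λ) (hgc : Continuous g)
    (hgb : ∃ C : ℝ, ∀ U, |g U| ≤ C) (k : ℕ) :
    ∫ U, g (timeShiftLG (G := G) k U) ∂μ = ∫ U, g U ∂μ :=
  integral_comp_configShift_of_mem_limitPoints r.ρ (oddTorusLimitPoints_subset_infiniteVolumeLimitPoints r β hμ) _ hg hgc hgb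

set_option maxHeartbeats 1600000 in
/-- **Transfer gap ⇒ RP-spectral gap.** If every odd-torus limit state at coupling `β ≥ 0` is OS-reconstructible for the bond
reflection with transfer data of mass gap `≥ m` (`HasInfiniteVolumeGap r β m`, the ladder's currency), then every odd-torus limit
state has RP-spectral gap `≥ m` in P3's site-reflection currency (`HasRPTimeGap μ m`).  Proof: for a positive-time observable `F`
with OS vector `v = ι F` and `w = v - ⟨Ω, v⟩ Ω ⟂ Ω`, translation invariance gives `rpCorr μ F (k+1) = Re ⟨w, T^k w⟩ ≤ e^{-mk} ‖w‖²
= e^{-mk} rpCorr μ F 1`; SITE-plane reflection positivity applied to `F + λ F∘τ` makes `λ ↦ rpCorr μ (F + λ F∘τ) 0 =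
rpCorr μ F 0 + 2λ rpCorr μ F 1 + λ² rpCorr μ F 2` non-negative, whence `rpCorr μ F 1 ≤ e^{-m} rpCorr μ F 0` (log-convexity at the
first step).  NOT THE CLAY GAP (a dictionary between two lattice gap currencies). [folklore] -/
theorem hasRPTimeGap_of_hasInfiniteVolumeGap (hβ : 0 ≤ β) {m : ℝ} (hgap : HasInfiniteVolumeGap r β m)
    [IsProbabilityMeasure μ] (hμ : μ ∈ oddTorusLimitPoints r β) : HasRPTimeGap μ m := by
  obtain ⟨h, hm⟩ := hgap μ hμ
  refine ⟨hm.1, fun F hF t => ?_⟩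
  -- the observable
  obtain ⟨Λ, hFΛ, hΛ0⟩ := hF.cyl
  have hΛ : (↑Λ : Set (QuantumLattice.ZdEdge 4)) ⊆ posTimeEdges := fun e he => by
    simpa [mem_posTimeEdges] using hΛ0 e (Finset.mem_coe.1 he)
  obtain ⟨C, hC⟩ := hF.bdd
  have bF : ∃ C : ℝ, ∀ U, |F U| ≤ C := ⟨C, hC⟩
  have bθ : ∃ C : ℝ, ∀ U, |F (timeReflectLG U)| ≤ C := ⟨C, fun U => hC _⟩
  have bΘ : ∃ C : ℝ, ∀ U, |F (gaugeTimeReflect U)| ≤ C := ⟨C, fun U => hC _⟩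
  have bs : ∀ k : ℕ, ∃ C : ℝ, ∀ U, |F (timeShiftLG (G := G) k U)| ≤ C := fun k => ⟨C, fun U => hC _⟩
  have cθ : Continuous fun U => F (timeReflectLG U) := hF.cont.comp continuous_timeReflectLG
  have cΘ : Continuous fun U => F (gaugeTimeReflect U) := hF.cont.comp continuous_gaugeTimeReflect
  have cs : ∀ k : ℕ, Continuous fun U => F (timeShiftLG (G := G) k U) := fun k =>
    hF.cont.comp (continuous_timeShiftLG k)
  have yΘ : IsCylinder (fun U => F (gaugeTimeReflect U)) _ := isCylinder_comp_gaugeTimeReflect hFΛ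
  have ys := fun k : ℕ => isCylinder_timeShift hFΛ k
  -- (R1) `∫ F∘θ · F∘α_{k+1} = ∫ F∘Θ · F∘α_k`, (R2) `∫ F∘θ = ∫ F∘Θ`, (R3) `∫ F∘α_k = ∫ F`
  have R1 : ∀ k : ℕ, ∫ U, F (timeReflectLG U) * F (timeShiftLG (G := G) (k + 1) U) ∂μ =
      ∫ U, F (gaugeTimeReflect U) * F (timeShiftLG (G := G) k U) ∂μ := by
    intro k
    have hinv := integral_comp_gaugeTimeShift r hμ
      (g := fun U => F (gaugeTimeReflect U) * F (timeShiftLG (G := G) k U))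
      (isCylinder_map₂ (fun a b : ℝ => a * b) yΘ (ys k)) (cΘ.mul (cs k)) (bdd_mul bΘ (bs k))
    refine Eq.trans ?_ hinv
    refine integral_congr_ae (ae_of_all _ fun U => ?_)
    simp only [gaugeTimeReflect_gaugeTimeShift, timeShiftLG_gaugeTimeShift]
  have R2 : ∫ U, F (timeReflectLG U) ∂μ = ∫ U, F (gaugeTimeReflect U) ∂μ := by
    refine Eq.trans ?_ (integral_comp_gaugeTimeShift r hμ (g := fun U => F (gaugeTimeReflect U)) yΘ cΘ bΘ)
    refine integral_congr_ae (ae_of_all _ fun U => ?_)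
    simp only [gaugeTimeReflect_gaugeTimeShift]
  have R3 : ∀ k : ℕ, ∫ U, F (timeShiftLG (G := G) k U) ∂μ = ∫ U, F U ∂μ := fun k =>
    integral_comp_timeShiftLG r hμ hFΛ hF.cont bF k
  -- OS side: `v = ι F`, `w = v - ⟨Ω, v⟩ Ω`
  set Fc : LGConfig 4 G → ℂ := fun U => ((F U : ℝ) : ℂ) with hFc_def
  have hFcyl : IsCylinder Fc Λ := fun U V hUV => by simp only [hFc_def, hFΛ hUV]
  have hFc : IsBoundedMeasurable (posTimeEvents G) Fc :=
    isBoundedMeasurable_of_continuous hFcyl hΛ (Complex.continuous_ofReal.comp hF.cont)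
      (C := C) fun U => by rw [hFc_def, Complex.norm_real, Real.norm_eq_abs]; exact hC U
  have hOS := h.isOSRealisation
  set D := h.transferData with hD
  set v := h.osMap Fc with hv
  obtain ⟨w, hw, hdec⟩ : ∃ w, w ∈ (D.vacuumLine)ᗮ ∧ v = ⟪D.vacuum, v⟫_ℂ • D.vacuum + w := by
    refine ⟨(D.vacuumLine)ᗮ.starProjection v, Submodule.starProjection_apply_mem _ v, ?_⟩
    have h1 := Submodule.starProjection_add_starProjection_orthogonal (K := ℂ ∙ D.vacuum) v
    rw [Submodule.starProjection_unit_singleton (𝕜 := ℂ) D.norm_vacuum v] at h1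
    exact h1.symm
  have hkey : ∀ k : ℕ, ⟪v, (D.T ^ k) v⟫_ℂ - ⟪v, D.vacuum⟫_ℂ * ⟪D.vacuum, v⟫_ℂ = ⟪w, (D.T ^ k) w⟫_ℂ := by
    intro k
    have horth : ⟪D.vacuum, (D.T ^ k) w⟫_ℂ = 0 := by
      have hmem := (D.pow_apply_mem_orthogonal_and_norm_le hw k).1
      rw [TransferData.vacuumLine, Submodule.mem_orthogonal_singleton_iff_inner_right] at hmem
      exact hmem
    have hTv : (D.T ^ k) v = ⟪D.vacuum, v⟫_ℂ • D.vacuum + (D.T ^ k) w := by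
      conv_lhs => rw [hdec]
      rw [map_add, map_smul, D.pow_apply_vacuum]
    have hvw : ⟪v, (D.T ^ k) w⟫_ℂ = ⟪w, (D.T ^ k) w⟫_ℂ := by
      conv_lhs => rw [hdec]
      rw [inner_add_left, inner_smul_left, horth, mul_zero, zero_add]
    rw [hTv, inner_add_right, inner_smul_right, hvw]
    ring
  -- the connected bond correlator is `Re ⟨w, T^k w⟩`
  have hconn : ∀ k : ℕ, (∫ U, F (gaugeTimeReflect U) * F (timeShiftLG (G := G) k U) ∂μ) -
      (∫ U, F (gaugeTimeReflect U) ∂μ) * (∫ U, F U ∂μ) = (⟪w, (D.T ^ k) w⟫_ℂ).re := by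
    intro k
    have hb : (((∫ U, F (gaugeTimeReflect U) * F (timeShiftLG (G := G) k U) ∂μ : ℝ)) : ℂ) =
        ⟪v, (D.T ^ k) v⟫_ℂ := by
      rw [hv, hD, ← hOS.integral_conj_comp_reflect_mul_comp_iterate hFc hFc k, ← integral_complex_ofReal]
      refine integral_congr_ae (ae_of_all _ fun U => ?_)
      simp only [hFc_def, Complex.conj_ofReal, Complex.ofReal_mul, gaugeTimeShift_iterate]
    have hmΘ : (((∫ U, F (gaugeTimeReflect U) ∂μ : ℝ)) : ℂ) = ⟪v, D.vacuum⟫_ℂ := by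
      rw [hv, hD, ← hOS.integral_conj_comp_reflect hFc, ← integral_complex_ofReal]
      refine integral_congr_ae (ae_of_all _ fun U => ?_)
      simp only [hFc_def, Complex.conj_ofReal]
    have hmF : (((∫ U, F U ∂μ : ℝ)) : ℂ) = ⟪D.vacuum, v⟫_ℂ := by
      rw [hv, hD, ← hOS.integral_eq_inner_vacuum hFc, ← integral_complex_ofReal]
    have hc : ((((∫ U, F (gaugeTimeReflect U) * F (timeShiftLG (G := G) k U) ∂μ) -
        (∫ U, F (gaugeTimeReflect U) ∂μ) * (∫ U, F U ∂μ) : ℝ)) : ℂ) = ⟪w, (D.T ^ k) w⟫_ℂ := by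
      rw [Complex.ofReal_sub, Complex.ofReal_mul, hb, hmΘ, hmF, hkey]
    have := congrArg Complex.re hc
    simpa only [Complex.ofReal_re] using this
  have hconn0 : (∫ U, F (gaugeTimeReflect U) * F (timeShiftLG (G := G) 0 U) ∂μ) -
      (∫ U, F (gaugeTimeReflect U) ∂μ) * (∫ U, F U ∂μ) = ‖w‖ ^ 2 := by
    have h1 : (D.T ^ 0) w = w := by simp
    rw [hconn 0, h1, inner_self_eq_norm_sq_to_K]
    norm_cast
  have hdecay : ∀ k : ℕ, (⟪w, (D.T ^ k) w⟫_ℂ).re ≤ Real.exp (-(m * k)) * ‖w‖ ^ 2 := by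
    intro k
    obtain ⟨-, hnorm⟩ := D.pow_apply_mem_orthogonal_and_norm_le hw k
    have hexp : D.gapNorm ^ k ≤ Real.exp (-(m * k)) := by
      calc D.gapNorm ^ k ≤ Real.exp (-m) ^ k := pow_le_pow_left₀ D.gapNorm_nonneg hm.2 k
        _ = Real.exp (-(m * k)) := by rw [← Real.exp_nat_mul]; congr 1; ring
    calc (⟪w, (D.T ^ k) w⟫_ℂ).re ≤ ‖⟪w, (D.T ^ k) w⟫_ℂ‖ := Complex.re_le_norm _
      _ ≤ ‖w‖ * ‖(D.T ^ k) w‖ := norm_inner_le_norm _ _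
      _ ≤ ‖w‖ * (D.gapNorm ^ k * ‖w‖) := mul_le_mul_of_nonneg_left hnorm (norm_nonneg _)
      _ ≤ ‖w‖ * (Real.exp (-(m * k)) * ‖w‖) :=
          mul_le_mul_of_nonneg_left (mul_le_mul_of_nonneg_right hexp (norm_nonneg _)) (norm_nonneg _)
      _ = Real.exp (-(m * k)) * ‖w‖ ^ 2 := by ring
  -- P3's currency: `rpCorr μ F (k+1)` is the connected bond correlator at `k`
  have hR : ∀ k : ℕ, rpCorr μ F (k + 1) = (∫ U, F (gaugeTimeReflect U) * F (timeShiftLG (G := G) k U) ∂μ) -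
      (∫ U, F (gaugeTimeReflect U) ∂μ) * (∫ U, F U ∂μ) := by
    intro k
    simp only [rpCorr]
    rw [R1 k, R2, R3 (k + 1)]
  have s1_eq : rpCorr μ F 1 = ‖w‖ ^ 2 := by rw [hR 0, hconn0]
  have s1_nonneg : 0 ≤ rpCorr μ F 1 := by rw [s1_eq]; positivity
  have hE : ∀ k : ℕ, rpCorr μ F (k + 1) ≤ Real.exp (-(m * k)) * rpCorr μ F 1 := fun k => by
    rw [hR k, hconn k, s1_eq]; exact hdecay k
  -- site-plane RP: the quadratic `λ ↦ rpCorr μ (F + λ F∘α_1) 0` is non-negative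
  have s0_nonneg : 0 ≤ rpCorr μ F 0 := rpCorr_zero_nonneg r hβ hμ hF
  have hs0 : rpCorr μ F 0 = (∫ U, F (timeReflectLG U) * F U ∂μ) -
      (∫ U, F (gaugeTimeReflect U) ∂μ) * (∫ U, F U ∂μ) := by
    simp only [rpCorr, timeShiftLG_zero, R2]
  have hquad : ∀ l : ℝ, 0 ≤ rpCorr μ F 2 * (l * l) + 2 * rpCorr μ F 1 * l + rpCorr μ F 0 := by
    intro l
    have hA : IsPosTimeObs (fun U => F U + l * F (timeShiftLG (G := G) 1 U)) := by
      refine ⟨⟨_, isCylinder_add_smul hFΛ (ys 1) l, fun e he => ?_⟩,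
        hF.cont.add (continuous_const.mul (cs 1)), ?_⟩
      · rcases Finset.mem_union.1 he with he | he
        · exact hΛ0 e he
        · obtain ⟨e', he', rfl⟩ := Finset.mem_image.1 he
          have := hΛ0 e' he'
          simp only [Pi.add_apply, Pi.single_eq_same, Nat.cast_one]
          linarith
      · exact ⟨C + |l| * C, fun U => by
          calc |F U + l * F (timeShiftLG (G := G) 1 U)|
              ≤ |F U| + |l * F (timeShiftLG (G := G) 1 U)| := abs_add_le _ _
            _ = |F U| + |l| * |F (timeShiftLG (G := G) 1 U)| := by rw [abs_mul]
            _ ≤ C + |l| * C := add_le_add (hC _) (mul_le_mul_of_nonneg_left (hC _) (abs_nonneg _))⟩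
    have h0 := rpCorr_zero_nonneg r hβ hμ hA
    have hIA : ∫ U, (F (timeReflectLG U) + l * F (gaugeTimeReflect U)) *
        (F U + l * F (timeShiftLG (G := G) 1 U)) ∂μ =
        (∫ U, F (timeReflectLG U) * F U ∂μ) + l * (∫ U, F (timeReflectLG U) * F (timeShiftLG (G := G) 1 U) ∂μ)
          + l * (∫ U, F (gaugeTimeReflect U) * F U ∂μ)
          + l * l * (∫ U, F (gaugeTimeReflect U) * F (timeShiftLG (G := G) 1 U) ∂μ) :=
      integral_add_mul_add cθ bθ cΘ bΘ hF.cont bF (cs 1) (bs 1) l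
    have hIθ : ∫ U, (F (timeReflectLG U) + l * F (gaugeTimeReflect U)) ∂μ =
        (∫ U, F (timeReflectLG U) ∂μ) + l * (∫ U, F (gaugeTimeReflect U) ∂μ) := by
      rw [integral_add (integrable_of_continuous_bdd cθ bθ)
        ((integrable_of_continuous_bdd cΘ bΘ).const_mul l), integral_const_mul]
    have hI : ∫ U, (F U + l * F (timeShiftLG (G := G) 1 U)) ∂μ =
        (∫ U, F U ∂μ) + l * (∫ U, F (timeShiftLG (G := G) 1 U) ∂μ) := by
      rw [integral_add (integrable_of_continuous_bdd hF.cont bF)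
        ((integrable_of_continuous_bdd (cs 1) (bs 1)).const_mul l), integral_const_mul]
    have hexp : rpCorr μ (fun U => F U + l * F (timeShiftLG (G := G) 1 U)) 0 =
        rpCorr μ F 2 * (l * l) + 2 * rpCorr μ F 1 * l + rpCorr μ F 0 := by
      have h01 := R1 0
      simp only [zero_add, timeShiftLG_zero] at h01
      rw [hR 1, hR 0, hs0]
      simp only [rpCorr, timeShiftLG_zero, timeShiftLG_one_timeReflectLG]
      rw [hIA, hIθ, hI, h01, R2, R3 1]
      ring
    rw [← hexp]
    exact h0
  have hdisc := discrim_le_zero hquad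
  rw [discrim] at hdisc
  have s2_le : rpCorr μ F 2 ≤ Real.exp (-m) * rpCorr μ F 1 := by
    have := hE 1
    simpa using this
  have s1_le : rpCorr μ F 1 ≤ Real.exp (-m) * rpCorr μ F 0 := by
    by_cases hs1 : rpCorr μ F 1 = 0
    · rw [hs1]; positivity
    · have hpos : 0 < rpCorr μ F 1 := lt_of_le_of_ne s1_nonneg (Ne.symm hs1)
      have h1 : rpCorr μ F 1 * rpCorr μ F 1 ≤ rpCorr μ F 2 * rpCorr μ F 0 := by nlinarith [hdisc]
      have h2 : rpCorr μ F 2 * rpCorr μ F 0 ≤ Real.exp (-m) * rpCorr μ F 1 * rpCorr μ F 0 :=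
        mul_le_mul_of_nonneg_right s2_le s0_nonneg
      have h3 : rpCorr μ F 1 * rpCorr μ F 1 ≤ (Real.exp (-m) * rpCorr μ F 0) * rpCorr μ F 1 := by
        calc rpCorr μ F 1 * rpCorr μ F 1 ≤ rpCorr μ F 2 * rpCorr μ F 0 := h1
          _ ≤ Real.exp (-m) * rpCorr μ F 1 * rpCorr μ F 0 := h2
          _ = (Real.exp (-m) * rpCorr μ F 0) * rpCorr μ F 1 := by ring
      exact le_of_mul_le_mul_right h3 hpos
  -- conclusion
  cases t with
  | zero => simp
  | succ k =>
    calc rpCorr μ F (k + 1) ≤ Real.exp (-(m * k)) * rpCorr μ F 1 := hE k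
      _ ≤ Real.exp (-(m * k)) * (Real.exp (-m) * rpCorr μ F 0) :=
          mul_le_mul_of_nonneg_left s1_le (Real.exp_pos _).le
      _ = Real.exp (-(m * ((k + 1 : ℕ) : ℝ))) * rpCorr μ F 0 := by
          rw [← mul_assoc, ← Real.exp_add]
          push_cast
          ring_nf

end TransferToRP

end Summit.QuantumFields.YangMills.Theorems.WeakCouplingRates

end
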